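import Summits.ValiantsHypothesis.ValiantsHypothesis.Theses.TwoAdicLadder
import Summits.ValiantsHypothesis.ValiantsHypothesis.Theorems.TwoAdicLadderCeilingModFour

/-!
# TwoAdicLadder, aside `OddPerNotVPF2` (stmt-ValiantsHypothesis-21028) — REFUTED

The item asserts that the odd-permutation family `Q̄_n = Σ_{sign σ = −1} ∏ᵢ x_{i σ(i)}` is NOT
p-computable over `𝔽₂ = ZMod 2` ("rung k = 1 of the precision ladder").  It is p-computable:
over `𝔽₂`, `Q̄_n = Σ_{a<b, i<i'} det N^{ab}_{ii'}` is a sum of `n⁴` substitution instances of `det_n`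
(the tree's `TwoAdicLadder.sum_det_pinned_eq_oddPerm`, the mod-2 core of the landed `CeilingModFour`:
count inversions by the inverted column pair; `inv(σ) ≡ [σ odd] (mod 2)`), so
`L(Q̄_n) ≤ n⁴ · L(det_n) + n⁴` is p-bounded by Berkowitz (`isVPFamily_detPoly_of_commRing`).
-/

noncomputable section

open MvPolynomial

-- the summit and the problem share the name `ValiantsHypothesis` (D-0017 single-conjunct layout)
set_option linter.dupNamespace false

namespace Summit.ValiantsHypothesis.ValiantsHypothesis.Theorems

open Literature.Computability.AlgebraicComplexity

/-- Refutes `TwoAdicLadder.OddPerNotVPF2` [refuted-substantive]: the odd-permutation polynomial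
family `Q̄_n = Σ_{sign σ = −1} ∏ᵢ x_{i σ(i)}` IS p-computable over `ZMod 2`; witness: the in-tree
identity `Q̄_n ≡ Σ_{a<b, i<i'} det N^{ab}_{ii'}` (`TwoAdicLadder.sum_det_pinned_eq_oddPerm`, `n⁴` pinned
substitution instances of `det_n`, each of complexity `≤ L(det_n)` by
`TwoAdicLadder.complexity_det_pinned_le`), whence `L(Q̄_n) ≤ n⁴ L(det_n) + n⁴`, p-bounded by
`isVPFamily_detPoly_of_commRing (ZMod 2)`.  No cheap repair: the `ℤ/4` form (`per ∈ VP_{ℤ/4}`) is the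
landed `CeilingModFour`, every fixed precision `ℤ/2^k` is the landed `CeilingAllPrecisions`; only the
`k → ∞` statement (`PrecisionLadder`, item 5948, implied by VH) survives — a fixed 2-adic digit of the
permanent is a polynomial-size determinant sum (Valiant 1979 §4 made symbolic).
barrier-candidate: fixed 2-adic precision separates nothing (per ≡ det + 2·J mod 4, J ∈ VP).
[cite: Valiant1979Permanent, §4] [folklore] -/
theorem TwoAdicLadderOddPerNotVPF2_refuted :
    ¬ Summit.ValiantsHypothesis.ValiantsHypothesis.Theses.TwoAdicLadder.OddPerNotVPF2 := by
  intro h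
  refine h ?_
  classical
  unfold IsPComputable
  have hdet : IsPBounded fun n => complexity (detPoly (Fin n) (ZMod 2)) :=
    (isVPFamily_detPoly_of_commRing (ZMod 2)).2
  have hpow : IsPBounded fun n : ℕ => n ^ 4 := ⟨4, fun n => Nat.le_add_right _ _⟩
  refine IsPBounded.mono (IsPBounded.add_holds (IsPBounded.mul_holds hpow hdet) hpow) fun n => ?_
  dsimp only
  rw [TwoAdicLadder.oddPerm_sum_eq (R := ZMod 2) n, ← TwoAdicLadder.sum_det_pinned_eq_oddPerm n]
  have hcard : (Finset.univ : Finset (Fin n × Fin n × Fin n × Fin n)).card = n ^ 4 := by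
    simp only [Finset.card_univ, Fintype.card_prod, Fintype.card_fin]
    ring
  refine (complexity_finset_sum_le _ _).trans ?_
  rw [hcard]
  refine Nat.add_le_add_right ?_ _
  have hterm : ∀ q ∈ (Finset.univ : Finset (Fin n × Fin n × Fin n × Fin n)),
      complexity (if q.1 < q.2.1 ∧ q.2.2.1 < q.2.2.2 then
        (Matrix.of fun r c : Fin n =>
          if (c = q.1 → r = q.2.2.2) ∧ (c = q.2.1 → r = q.2.2.1) then
            (X (r, c) : MvPolynomial (Fin n × Fin n) (ZMod 2)) else 0).det
        else 0) ≤ complexity (detPoly (Fin n) (ZMod 2)) := by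
    intro q _
    split_ifs
    · exact TwoAdicLadder.complexity_det_pinned_le _ _ _ _
    · rw [← C_0, complexity_C_holds]
      exact Nat.zero_le _
  refine (Finset.sum_le_card_nsmul _ _ _ hterm).trans ?_
  rw [hcard, smul_eq_mul]

end Summit.ValiantsHypothesis.ValiantsHypothesis.Theorems

end
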